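import Mathlib
import Literature.Analysis.FluidPDE.KNSSTypeIIHolds
import Summits.NavierStokesRegularity.NavierStokesRegularity.Theses.ExtremalEnstrophy
import HarnessLib

/-!
# `ExtremalEnstrophy.EnstrophyContinuation` — continuation past `T` under a uniform weak-enstrophy
  bound (item stmt-NavierStokesRegularity-18669)

**Statement.** For `ν, T > 0` and a classical solution `(u, p)` of unforced Navier–Stokes on
`ℝ³ × [0, T)`, Leray–Hopf on `[0, T]` from `u 0`: if the weak dissipation `eWeakGradL2Sq (u t)` is
bounded by some `M` for all `t ∈ [0, T)`, then `u` extends as a classical solution past `T`.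

PROOF. Word for word the `H¹`-lifespan argument of the sibling file
`Theorems/QuasipotentialCoercivityEnstrophyClosure.lean` (item stmt-10592, the classical-enstrophy
twin): Leray's local regular `H¹` theory (`leray_local_regular_H1_holds`, lifespan `c ν³ / M²`)
from a good restarting time `s` close to `T` (`IsLerayHopfOn.exists_isLerayHopfOn_restart_Ioo`),
weak–strong uniqueness in `L^∞_t L⁶_x` (`serrin_weak_strong_uniqueness_holds`), and gluing
(`IsClassicalNSSolutionOn.glue`); here the `H¹` bound of the restart datum is the hypothesis itself.

HONEST FRAMING: a known continuation criterion; nothing here bears on whether such bounds hold.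
-/

noncomputable section

set_option linter.dupNamespace false

namespace Summit.NavierStokesRegularity.NavierStokesRegularity.Theorems

open Set MeasureTheory Filter Topology
open scoped ENNReal NNReal
open Literature.Analysis.FluidPDE

/-- **Uniform weak-enstrophy bound ⇒ classical continuation past `T`** (Leray 1934; RRS 2016
Thm. 6.15 + weak–strong uniqueness): a classical solution of unforced NS on `ℝ³ × [0, T)`,
Leray–Hopf on `[0, T]` from `u 0`, with `eWeakGradL2Sq (u t) ≤ M` on `[0, T)`, extends classically
past `T`. [this file] -/
theorem hasSmoothExtensionPast_of_eWeakGradL2Sq_le {ν T : ℝ} (hν : 0 < ν) (hT : 0 < T)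
    {u : ℝ → EuclideanSpace ℝ (Fin 3) → EuclideanSpace ℝ (Fin 3)}
    {p : ℝ → EuclideanSpace ℝ (Fin 3) → ℝ}
    (hcl : IsClassicalNSSolutionOn (Ico 0 T) ν 0 u p) (hLH : IsLerayHopfOn T ν 0 (u 0) u)
    {M : ℝ≥0} (hens : ∀ t ∈ Ico 0 T, eWeakGradL2Sq (u t) ≤ M) :
    HasSmoothExtensionPast ν 0 u T := by
  classical
  obtain ⟨c, hc, hlocc⟩ := leray_local_regular_H1_holds
  -- Leray's lifespan for data of squared weak-gradient norm `≤ a = M`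
  set a : ℝ := (M : ℝ) with ha
  have ha0 : 0 ≤ a := M.coe_nonneg
  set τ : ℝ := c * ν ^ 3 / (a ^ 2 + 1) with hτ
  have hcν : 0 < c * ν ^ 3 := mul_pos hc (pow_pos hν 3)
  have hτpos : 0 < τ := div_pos hcν (by positivity)
  have hτc : a ^ 2 * τ ≤ c * ν ^ 3 := by
    have h1 : a ^ 2 * τ = c * ν ^ 3 * (a ^ 2 / (a ^ 2 + 1)) := by
      rw [hτ]
      ring
    rw [h1]
    exact mul_le_of_le_one_right hcν.le (div_le_one_of_le₀ (by linarith) (by positivity))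
  -- a good restart time `s ∈ (max (T/2) (T - τ/2), T)`
  set s₀ : ℝ := max (T / 2) (T - τ / 2) with hs₀
  have hs₀0 : 0 ≤ s₀ := le_max_of_le_left (by linarith)
  have hs₀T : s₀ < T := max_lt (by linarith) (by linarith)
  obtain ⟨s, hs, hLHs⟩ := hLH.exists_isLerayHopfOn_restart_Ioo hν.le hs₀0 hs₀T le_rfl
  have hsT2 : T / 2 ≤ s := (le_max_left _ _).trans hs.1.le
  have hsτ : T < s + τ := by
    have h1 : T - τ / 2 < s := (le_max_right _ _).trans_lt hs.1
    linarith
  have hs0 : 0 < s := by linarith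
  have hTs : 0 < T - s := sub_pos.2 hs.2
  have hTsτ : T - s ≤ τ := by linarith
  have hsI : s ∈ Ico 0 T := ⟨hs0.le, hs.2⟩
  -- the datum `u s ∈ H¹`, weakly divergence free, with `‖∇u(s)‖² ≤ a`
  have hu2 : MemLp (u s) 2 volume := hLH.memLp s ⟨hs0.le, hs.2.le⟩
  have hdiv : IsWeaklyDivFree (u s) := hLHs.isWeaklyDivFree_datum hTs
  have hgrad : eWeakGradL2Sq (u s) ≤ ENNReal.ofReal a := by
    rw [ha, ENNReal.ofReal_coe_nnreal]
    exact hens s hsI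
  -- Leray's local regular solution `(v, q)` from `u s` on `[0, τ]` (Leray 1934; RRS Thm. 6.15)
  obtain ⟨v, q, hv, hv0, hvreg, hvcl, -⟩ := hlocc hν hτpos hu2 hdiv ha0 hgrad hτc
  -- it lies in the Serrin class `L^∞_t L⁶_x`
  have hvS : MemLqLp ∞ 6 v (Ioo 0 τ) :=
    memLqLp_top_six_of_isH1RegularOn_Icc hvreg fun t ht => hv.memLp t ht
  have hr6 : (3 : ℝ≥0∞) < 6 := by norm_num
  -- weak–strong uniqueness on `[0, T - s)`: `u (t + s) = v t` a.e., `0 < t ≤ T - s`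
  have hae : ∀ t ∈ Ioc 0 (T - s), (fun t => u (t + s)) t =ᵐ[volume] v t :=
    serrin_weak_strong_uniqueness_holds hν hTs (hv.of_le hTsτ) hu2 (q := ∞) (r := 6) hr6
      serrin_exponents_top_six (hvS.mono_set (Ioo_subset_Ioo_right hTsτ)) hLHs
  -- everywhere agreement of the continuous slices on `(s, T)`
  have heq : ∀ t ∈ Ioo s T, u t = v (t + -s) := by
    intro t ht
    have hts : t - s ∈ Ioc 0 (T - s) := ⟨sub_pos.2 ht.1, by linarith [ht.2]⟩
    have h1 : u t =ᵐ[volume] v (t - s) := by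
      have h := hae (t - s) hts
      simpa only [sub_add_cancel] using h
    have hcu : Continuous (u t) :=
      (hcl.contDiff_velocity ⟨hs0.le.trans ht.1.le, ht.2⟩).continuous
    have hcV : Continuous (v (t - s)) :=
      (hvcl.contDiff_velocity ⟨hts.1, hts.2.trans hTsτ⟩).continuous
    rw [← sub_eq_add_neg]
    exact (Continuous.ae_eq_iff_eq volume hcu hcV).1 h1
  -- the continuation piece `(v, q)(· - s)` on `(s, s + τ)`
  have h₂ : IsClassicalNSSolutionOn (Ioo s (s + τ)) ν 0 (fun t => v (t + -s))
      (fun t => q (t + -s)) := by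
    have hVP' := hvcl.comp_add_right (-s)
    have h0 : (fun t => (0 : ℝ → EuclideanSpace ℝ (Fin 3) → EuclideanSpace ℝ (Fin 3)) (t + -s))
        = 0 := rfl
    rw [h0] at hVP'
    exact hVP'.mono (fun t ht => ⟨by simp only [mem_Ioo] at ht ⊢; linarith [ht.1],
      by simp only [mem_Ioo] at ht ⊢; linarith [ht.2]⟩) isOpen_Ioo.uniqueDiffOn
  -- glue along the overlap `(s, T)`
  exact ⟨s + τ, hsτ, _, _, hcl.glue h₂ hs0.le hs.2 hsτ.le heq, fun t ht => by
    simp only [if_pos ht.2]⟩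

/-- **Item stmt-NavierStokesRegularity-18669** (`ExtremalEnstrophy.EnstrophyContinuation`): bounded
weak enstrophy on `[0, T)` continues a classical Leray–Hopf solution past `T`
(`hasSmoothExtensionPast_of_eWeakGradL2Sq_le`). [this file] -/
theorem extremalEnstrophy_enstrophyContinuation_proof :
    Summit.NavierStokesRegularity.NavierStokesRegularity.Theses.ExtremalEnstrophy.EnstrophyContinuation := by
  unfold Summit.NavierStokesRegularity.NavierStokesRegularity.Theses.ExtremalEnstrophy.EnstrophyContinuation
  intro ν T u p hν hT hcl hLH hM
  obtain ⟨M, hM⟩ := hM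
  exact hasSmoothExtensionPast_of_eWeakGradL2Sq_le hν hT hcl hLH hM

end Summit.NavierStokesRegularity.NavierStokesRegularity.Theorems

end
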